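import Mathlib.Data.Real.Basic
import Mathlib.Order.Interval.Set.Basic
import Mathlib.Tactic.Linarith
import Literature.IUT.LogThetaLattice.ThetaPilotObjects
import HarnessLib

/-!
# [IUTchIII] Remark 3.12.2 (ii): the "(a^itw)–(f^itw)" summary and the toy model "(a^toy)–(f^toy)" (c312 crew, wave 2, II)

S. Mochizuki, *Inter-universal Teichmüller theory III*, author's kurims manuscript (May 2020) of PRIMS
**57** (2021), §3, Remark 3.12.2 (ii), kurims p. 187 l. 34 – p. 191 l. 33 (PRIMS offset ≈ +420…+424),
READ ON THE PAGE by this seat (abc-iut-c312-8, 2026-08-25; `paper:url-4b091feeb646`). Siblings: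
`Cor312Remarks.lean` (Rmk 3.12.1, Rmk 3.12.2 (i)), `Cor312Remarks2.lean` (Rmk 3.12.2 (iii)–(v), 3.12.3,
3.12.4). Record-only typing of a DISPUTED text (D-0012 claim key `Mochizuki2012`): every declaration
quotes the printed sentence it types; nothing here takes a side on Corollary 3.12; "typed" ≠ "discharged".

**IUTchIII:Rmk3.12.2(ii)** is CITED by Step (xi-a) of the proof of Cor. 3.12 (p. 181 l. 44; c312-2's
`Summit.ABC.IUTFork.Cor312Proof.Locus.rem3_12_2_ii`). Three typed layers:
1. the "(a^itw)–(f^itw)" summary (pp. 188–189) as the propositional frame `Itw` (`Citw` = the display of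
   (c^itw) "(q-intertwining holds) ∧ (Θ-intertwining holds)"; `FirstArrow`/`secondArrow`/`fitw` = the
   display of (f^itw) `(q-itw.) ⟹ (q-itw.) ∧ (Θ-itw./indets.) ⟹ (Θ-itw./indets.)` with "the second «⟹» …
   purely formal" PROVED and the first «⟹» a HYPOTHESIS; `ImageOfCitw` = "the «∧» of the above display
   may be regarded as the «image» of … the «∧» in the display of (c^itw)"; `firstArrow_iff` records,
   neutrally, that the first arrow carries exactly `q-itw. → Θ-itw./indets.`);
2. the mechanism (b^itw) "sufficiently weakened data [namely, the `𝓕^{⊩▶×μ}`-prime-strips that appear in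
   the definition of the Θ^{×μ}_{LGP}-link]" BOUND BY NAME to abc-iut-L6-t4's landed [IUTchIII] Def. 3.8
   (ii) decl: `bitw_link_eq_univ` (the Θ^{×μ}_{LGP}-link `Literature.IUT.LogThetaLattice.thetaLGPLink` IS
   the full poly-isomorphism — `rfl`);
3. the author's "[very rough!] toy model" (a^toy)–(f^toy) pp. 189 l. 63 – 191 l. 33 typed VERBATIM over
   `ℝ` and PROVED line by line: `Toy` (`h, ε > 0`), labelled copies `qℝ`, `Θℝ` (`Toy.Label`),
   `lamQ : ∗ ↦ q(−h)`, `lamTheta : ∗ ↦ Θ(−2h)`, `atoy_forget_ne`/`atoy_not_simultaneous` ("if one forgets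
   the distinct labels … they contradict one another [`−h ≠ −2h`]"), `btoy_ctoy_simultaneous` (with the
   abstract symbol and distinct labels both assignments coexist), `lamThetaInd : ∗ ↦ Θℝ_{≤ −2h+ε}`
   ((d^toy)), `dtoy_mem` (a "version with indeterminacies" of `∗ ↦ −2h`), `SpecialCase` ((e^toy)/(f^toy):
   "«∗ ↦ −h» may be regarded as a special case of «∗ ↦ ℝ_{≤−2h+ε}»"), `ftoy_bound` ("one then concludes
   formally that `−h ∈ ℝ_{≤−2h+ε}` and hence … `h ≤ ε`" — PROVED), and the neutral kernel facts
   `specialCase_iff` (at this level the (e^toy) supposition is EQUIVALENT to the bound `h ≤ ε`) and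
   `itwAt_citw_false` (with the copies identified, "(q-itw.) ∧ (Θ-itw.)" at a single value is
   contradictory — the toy form of (a^toy)).
(d^itw)/(e^itw) ("parallel transport … up to the relatively mild «monodromy» constituted by (Ind1),
(Ind2), (Ind3)") are interpretive; quoted in `Itw`'s docstring, not typed separately.

Relation to the skeleton: the toy model is the in-paper sibling of Mochizuki's (Smm) typed in
`ForkCopies.lean` §3 (Report 2018 §1: `−2B = −A`, `−2B ≤ −2A + 1` ⟹ `A ≤ 1`): with `A := h` the toy reads
`−h ≤ −2h + ε`, i.e. (Smm)'s bound is the toy with `ε = 1` (`Toy.specialCase_iff`); a kernel bridge is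
deferred until `ForkCopies` is built on the farm (append-only addition). Deliberately NOT here: what
Theorem 3.11 delivers (c312-1), the proof chain (c312-2), log-volumes/hulls (L6-t4, S2, c312-3/6/7).
-/

namespace Summit.ABC.IUTFork.Cor312Rmk

/-! ## Remark 3.12.2 (ii): (a^itw)–(f^itw), the mechanism (b^itw), and the toy model (a^toy)–(f^toy) -/

/-- **IUTchIII:Rmk3.12.2(ii)** (kurims p. 187 l. 34 – p. 189 l. 62), the propositional frame of the summary
"(a^itw)–(f^itw)" of "the argument of the proof of Corollary 3.12" (p. 188 l. 2–3). The three
propositions are parameters: `qItw` = "q-intertwining holds" ((c^itw) p. 188 l. 40: "the intertwining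
associated to the q-pilot object in the codomain of the Θ^{×μ}_{LGP}-link"), `thetaItw` = "Θ-intertwining
holds" ("the intertwining associated to the Θ-pilot object in the domain of the Θ^{×μ}_{LGP}-link"),
`thetaItwIndets` = "Θ-itw./indets." ((f^itw) p. 189 l. 43–45: "«/indets.» … «up to suitable
indeterminacies»"). Interpretive sentences kept as quotations only: (a^itw) p. 188 l. 4–8 "the
correspondence of the Θ^{×μ}_{LGP}-link [i.e., that sends Θ-pilot objects to q-pilot objects] may seem a
bit «mysterious» or even, at first glance, «self-contradictory»"; (d^itw) p. 188 l. 48–60 "up to the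
relatively mild «monodromy» constituted by the indeterminacies (Ind1), (Ind2), (Ind3), one may «parallel
transport» or «confuse» the Θ-pilot object in the domain of the Θ^{×μ}_{LGP}-link … with the Θ-pilot object
represented relative to the «alien intertwining/arithmetic holomorphic structure» in the codomain";
(e^itw) p. 188 l. 61 – p. 189 l. 16 "one may fix the arithmetic holomorphic structure of the codomain …
and then, by applying (d^itw) and working up to the indeterminacies (Ind1), (Ind2), (Ind3) …, construct the
«native intertwining/arithmetic holomorphic structure» associated to the Θ-pilot object in the domain …
as a mathematical structure that is intrinsically associated to the underlying structure of — hence, in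
particular, simultaneously with/without invalidating the conditions imposed by — the «native
intertwining/arithmetic holomorphic structure» associated to the q-pilot object in the codomain …
Indeed, this point of view is precisely the point of view that is taken in the proof of Corollary 3.12
[cf., especially, Step (xi)]." [cite: Mochizuki2012, III Rmk 3.12.2 (ii) p.188] -/
structure Itw where
  /-- "q-intertwining holds" -/
  qItw : Prop
  /-- "Θ-intertwining holds" -/
  thetaItw : Prop
  /-- "Θ-itw./indets." = "Θ-intertwining holds up to suitable indeterminacies" -/
  thetaItwIndets : Prop

namespace Itw

variable (I : Itw)

/-- The display of **(c^itw)** (p. 188 l. 39–45): "the Θ^{×μ}_{LGP}-link yields a situation in which both the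
Θ-intertwining … and the q-intertwining … are simultaneously valid, i.e., (q-intertwining holds) ∧
(Θ-intertwining holds) — cf. the discussion of the «distinct labels approach» in Remark 3.11.1, (vii)"
— "essentially a tautological consequence of the fact that these two arithmetic holomorphic structures
in the domain and codomain of the Θ^{×μ}_{LGP}-link are distinguished from one another" (l. 27–30).
[cite: Mochizuki2012, III Rmk 3.12.2 (ii) p.188] -/
@[claim "Mochizuki2012" "disputed"]
def Citw : Prop := I.qItw ∧ I.thetaItw

/-- The FIRST «⟹» of the display of **(f^itw)** (p. 189 l. 18–38): "The multiradial representation of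
Theorem 3.11 … may be thought of [cf. the first «⟹» of the following display] as an algorithm for
constructing, up to suitable indeterminacies …, the «Θ-intertwining» as a mathematical structure that is
intrinsically associated to the underlying structure of — hence, in particular, simultaneously
with/without invalidating [cf. the logical relator «AND», i.e., «∧»] the conditions imposed by — the
«q-intertwining», while holding the «single abstract `𝓕^{⊩▶×μ}`-prime-strip» of the discussion of (b^itw),
(c^itw) fixed, i.e., in symbols: (q-itw.) ⟹ (q-itw.) ∧ (Θ-itw./indets.)". A HYPOTHESIS (this is what the
remark attributes to Theorem 3.11). [cite: Mochizuki2012, III Rmk 3.12.2 (ii) p.189] -/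
@[claim "Mochizuki2012" "disputed"]
def FirstArrow : Prop := I.qItw → I.qItw ∧ I.thetaItwIndets

/-- The SECOND «⟹» of the display of (f^itw), `(q-itw.) ∧ (Θ-itw./indets.) ⟹ (Θ-itw./indets.)` — "where
the second «⟹» of the above display is purely formal" (p. 189 l. 43). PROVED (it is `∧`-elimination).
[cite: Mochizuki2012, III Rmk 3.12.2 (ii) p.189] -/
theorem secondArrow : I.qItw ∧ I.thetaItwIndets → I.thetaItwIndets := fun h => h.2

/-- The whole display of (f^itw) composed: granted the first arrow, `(q-itw.) ⟹ (Θ-itw./indets.)` — the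
remark's "Thus, at the level of logical relations, the q-intertwining … may be thought of as a special
case of the Θ-intertwining …, regarded up to suitable indeterminacies. Corollary 3.12 then follows,
essentially formally." (p. 189 l. 54–62). PROVED from the hypothesis `FirstArrow`.
[cite: Mochizuki2012, III Rmk 3.12.2 (ii) p.189] -/
theorem fitw (h1 : I.FirstArrow) : I.qItw → I.thetaItwIndets := fun hq => I.secondArrow (h1 hq)

/-- p. 189 l. 45–53: "the «∧» of the above display may be regarded as the «image» of, hence, in
particular, as a consequence of, the «∧» in the display of (c^itw), via the various (sub)quotient
operations discussed in Remark 3.9.5, (viii), i.e., whose subtle compatibility properties allow one to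
conclude the «∧» of the above display from the «∧» in the display of (c^itw)." Typed as the named
HYPOTHESIS `(c^itw)'s ∧ ⟹ (f^itw)'s ∧`. [cite: Mochizuki2012, III Rmk 3.12.2 (ii) p.189] -/
@[claim "Mochizuki2012" "disputed"]
def ImageOfCitw : Prop := I.Citw → I.qItw ∧ I.thetaItwIndets

/-- Bookkeeping: if the Θ-intertwining holds ((c^itw)) and (f^itw)'s «∧» is the image of (c^itw)'s «∧», then
the first arrow of (f^itw) holds. PROVED. [cite: Mochizuki2012, III Rmk 3.12.2 (ii) p.189] -/
theorem firstArrow_of_imageOfCitw (hΘ : I.thetaItw) (him : I.ImageOfCitw) : I.FirstArrow :=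
  fun hq => him ⟨hq, hΘ⟩

/-- Neutral kernel fact (not printed): the first arrow of (f^itw) is EQUIVALENT to the bare implication
`q-itw. → Θ-itw./indets.`; i.e. at the level of logical relations the content attributed to Theorem 3.11
by (f^itw) is exactly "the q-intertwining implies the Θ-intertwining up to indeterminacies", and the
rest of the display is formal. PROVED. [folklore] -/
theorem firstArrow_iff : I.FirstArrow ↔ (I.qItw → I.thetaItwIndets) :=
  ⟨fun h hq => (h hq).2, fun h hq => ⟨hq, h hq⟩⟩

end Itw

/-- **(b^itw)/(c^itw)** bound to the REAL definition (p. 188 l. 9–21): the correspondence of the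
Θ^{×μ}_{LGP}-link "is made possible by the fact that one works with Θ-pilot or q-pilot objects in terms of
«sufficiently weakened data» [namely, the `𝓕^{⊩▶×μ}`-prime-strips that appear in the definition of the
Θ^{×μ}_{LGP}-link], i.e., data that is «sufficiently weak» that one can no longer distinguish between Θ-pilot
and q-pilot objects"; "(c^itw) … a «single abstract `𝓕^{⊩▶×μ}`-prime-strip» that is regarded/only known up
to isomorphism". Step (xi-a) of the proof of Cor. 3.12 cites this sub-item for "the Θ^{×μ}_{LGP}-link from
(0,0) to (1,0) may be interpreted as a sort of gluing isomorphism … in such a way that the Θ-pilot object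
at (0,0) … corresponds to the q-pilot object at (1,0)" (p. 181 l. 37–44). In abc-iut-L6-t4's landed
typing of [IUTchIII] Def. 3.8 (ii) (`ThetaPilotObjects.lean`, p403954) the link IS the full
poly-isomorphism of `𝓕^{⊩▶×μ}`-prime-strips — every isomorphism of the weakened data belongs to it; that is
the kernel-visible form of "only known up to isomorphism". PROVED (`rfl`).
[cite: Mochizuki2012, III Rmk 3.12.2 (ii) p.188] -/
theorem bitw_link_eq_univ.{u, v, w} {HT : Type u} {LogLink : HT → HT → Type v} {Strip : Type u}
    {Iso : Strip → Strip → Type w}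
    (D : Literature.IUT.LogThetaLattice.ThetaLinkStrips LogLink Strip) {s t : HT}
    (lg : LogLink s t) (star : HT) :
    Literature.IUT.LogThetaLattice.thetaLGPLink (Iso := Iso) D lg star = Set.univ := rfl

/-! ### The toy model (a^toy)–(f^toy), pp. 189 l. 63 – 191 l. 33 -/

/-- **Rmk 3.12.2 (ii), (a^toy)** data (kurims p. 190 l. 2–9): "Consider two distinct copies `qℝ` and `Θℝ` of the
topological field of real numbers `ℝ`, equipped with labels «q» and «Θ», together with an abstract symbol
«∗» and assignments `λ_q : ∗ ↦ q(−h) ∈ qℝ`, `λ_Θ : ∗ ↦ Θ(−2h) ∈ Θℝ` … `h ∈ ℝ_{>0}` is a positive real number that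
we are interested in bounding from above", and (d^toy) l. 43: "`ϵ ∈ ℝ_{>0}` is some positive number". The
author flags the toy model as "[very rough!] … whose goal lies solely in representing certain overall
qualitative aspects of a situation" (p. 189 l. 63–65). [cite: Mochizuki2012, III Rmk 3.12.2 (ii) p.190] -/
structure Toy where
  /-- `h ∈ ℝ_{>0}`, "that we are interested in bounding from above" -/
  h : ℝ
  /-- `ϵ ∈ ℝ_{>0}` of (d^toy) -/
  ε : ℝ
  /-- `h > 0` -/
  h_pos : 0 < h
  /-- `ϵ > 0` -/
  ε_pos : 0 < ε

namespace Toy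

/-- The labels «q» and «Θ» of the two copies `qℝ`, `Θℝ` ((a^toy) p. 190 l. 2–3).
[cite: Mochizuki2012, III Rmk 3.12.2 (ii) p.190] -/
inductive Label
  /-- the label «q» -/ | q
  /-- the label «Θ» -/ | theta
  deriving DecidableEq

/-- An element of the disjoint union `qℝ ⊔ Θℝ` of the two labelled copies: a label and a real number
("we shall write «q(−)», «Θ(−)» to denote the respective elements/subsets of `qℝ`, `Θℝ` determined by an
element/subset «(−)» of `ℝ`", p. 190 l. 6–8). [cite: Mochizuki2012, III Rmk 3.12.2 (ii) p.190] -/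
abbrev Labelled : Type := Label × ℝ

/-- "If one forgets the distinct labels" (p. 190 l. 9): the underlying real number.
[cite: Mochizuki2012, III Rmk 3.12.2 (ii) p.190] -/
def forget : Labelled → ℝ := Prod.snd

variable (T : Toy)

/-- `λ_q : ∗ ↦ q(−h) ∈ qℝ` ((a^toy) p. 190 l. 5). [cite: Mochizuki2012, III Rmk 3.12.2 (ii) p.190] -/
def lamQ : Labelled := (.q, -T.h)

/-- `λ_Θ : ∗ ↦ Θ(−2h) ∈ Θℝ` ((a^toy) p. 190 l. 5). [cite: Mochizuki2012, III Rmk 3.12.2 (ii) p.190] -/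
def lamTheta : Labelled := (.theta, -2 * T.h)

/-- **(a^toy)** p. 190 l. 9–12: "If one forgets the distinct labels «q» and «Θ», then these two assignments
`λ_q`, `λ_Θ` are mutually incompatible … i.e., they contradict one another [in the sense that `ℝ ∋ −h ≠ −2h ∈
ℝ`]." PROVED (`h > 0`). [cite: Mochizuki2012, III Rmk 3.12.2 (ii) p.190] -/
theorem atoy_forget_ne : forget T.lamQ ≠ forget T.lamTheta := by
  have := T.h_pos
  simp only [forget, lamQ, lamTheta]
  intro h; linarith

/-- **(a^toy)**, "cannot be considered simultaneously" (p. 190 l. 11): with the labels forgotten there is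
no single value of «∗» in ONE copy of `ℝ` realising both assignments. PROVED.
[cite: Mochizuki2012, III Rmk 3.12.2 (ii) p.190] -/
theorem atoy_not_simultaneous : ¬ ∃ x : ℝ, x = forget T.lamQ ∧ x = forget T.lamTheta := by
  rintro ⟨x, h1, h2⟩
  exact T.atoy_forget_ne (h1.symm.trans h2)

/-- **(b^toy)/(c^toy)** p. 190 l. 13–36: what "renders the simultaneous consideration of the two
assignments `λ_q`, `λ_Θ` valid — i.e., at the level of logical relations, (∗ ↦ q(−h) ∈ qℝ) ∧ (∗ ↦ Θ(−2h) ∈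
Θℝ)" is (b^toy) "the use of the abstract symbol «∗», i.e., which is, a priori, entirely unrelated to any
copies of `ℝ`" and (c^toy) "the use of the distinct labels «q», «Θ» for the copies of `ℝ`". Typed: in the
labelled disjoint union the two values are distinct elements with distinct labels, and ONE assignment on
the abstract symbol — a function on labels — realises both simultaneously. PROVED.
[cite: Mochizuki2012, III Rmk 3.12.2 (ii) p.190] -/
theorem btoy_ctoy_simultaneous :
    T.lamQ.1 ≠ T.lamTheta.1 ∧
      ∃ star : Label → ℝ, star .q = forget T.lamQ ∧ star .theta = forget T.lamTheta :=
  ⟨by simp [lamQ, lamTheta], ⟨fun l => match l with | .q => -T.h | .theta => -2 * T.h, rfl, rfl⟩⟩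

/-- **(d^toy)** p. 190 l. 37–44: "an alternative approach to constructing the assignment `λ_Θ`: We
construct `λ_Θ` as the «assignment with indeterminacies» `λ^{Ind}_Θ : ∗ ↦ Θℝ_{≤−2h+ϵ} ⊆ Θℝ` — where `ℝ_{≤−2h+ϵ}
:= {x ∈ ℝ | x ≤ −2h + ϵ} ⊆ ℝ`". [cite: Mochizuki2012, III Rmk 3.12.2 (ii) p.190] -/
def lamThetaInd : Set ℝ := Set.Iic (-2 * T.h + T.ε)

/-- (d^toy)/(f^toy): `λ^{Ind}_Θ` "may be regarded as a «version with indeterminacies» of «`∗ ↦ −2h`»"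
(p. 191 l. 29–30): the exact value lies in the indeterminate region. PROVED (`ϵ > 0`).
[cite: Mochizuki2012, III Rmk 3.12.2 (ii) p.191] -/
theorem dtoy_mem : forget T.lamTheta ∈ T.lamThetaInd := by
  have := T.ε_pos
  simp only [forget, lamTheta, lamThetaInd, Set.mem_Iic]
  linarith

/-- **(e^toy)/(f^toy)** at the level of values (p. 190 l. 45 – p. 191 l. 30): (e^toy) supposes "that one
may construct the «assignment with indeterminacies» `λ^{Ind}_Θ` … as a mathematical structure that is
intrinsically associated to … the assignment `λ_q`, even if one forgets the labels «q», «Θ» …, i.e.,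
even if one identifies `qℝ`, `Θℝ`, in the usual way, with `ℝ` [cf. the properties (IPL), (SHE) of Remark
3.11.1, (iii)]", and (f^toy) summarises: "«`∗ ↦ −h`» may be regarded as a special case of «`∗ ↦
ℝ_{≤−2h+ϵ}`»". THIS is the proposition typed here (the toy form of Step (xi-f)'s inclusion `−|log(q)| ∈
ℝ_{≤−|log(Θ)|}`): the forgotten value of `λ_q` lies in the region of `λ^{Ind}_Θ`. A `Prop`, not asserted.
[cite: Mochizuki2012, III Rmk 3.12.2 (ii) p.191] -/
@[claim "Mochizuki2012" "disputed"]
def SpecialCase : Prop := forget T.lamQ ∈ T.lamThetaInd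

/-- The display of **(f^toy)** (p. 191 l. 13–27), `(∗ ↦ −h) ⟹ (∗ ↦ −h) ∧ (∗ ↦ ℝ_{≤−2h+ϵ}) ⟹ (∗ ↦ ℝ_{≤−2h+ϵ})`,
for the identified value `x` of «∗»: granted `SpecialCase`, the first arrow holds at `x = −h` (the second
is formal, `Itw.secondArrow`). PROVED. [cite: Mochizuki2012, III Rmk 3.12.2 (ii) p.191] -/
theorem ftoy_display (hs : T.SpecialCase) (x : ℝ) (hx : x = forget T.lamQ) :
    x = forget T.lamQ ∧ x ∈ T.lamThetaInd :=
  ⟨hx, hx ▸ hs⟩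

/-- **(f^toy)**, conclusion (p. 191 l. 30–33): "One then concludes formally that `−h ∈ ℝ_{≤−2h+ϵ}` and hence
that `−h ≤ −2h + ϵ`, i.e., `h ≤ ϵ` — that is to say, the desired upper bound on `h`." PROVED from
`SpecialCase`. [cite: Mochizuki2012, III Rmk 3.12.2 (ii) p.191] -/
theorem ftoy_bound (hs : T.SpecialCase) : T.h ≤ T.ε := by
  have hs' : -T.h ≤ -2 * T.h + T.ε := by
    simpa only [SpecialCase, forget, lamQ, lamThetaInd, Set.mem_Iic] using hs
  linarith

/-- Neutral kernel fact (not printed): at the level of the toy model the (e^toy) supposition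
`SpecialCase` is EQUIVALENT to the desired bound `h ≤ ϵ` — the toy-level counterpart of the skeleton's
`ForkLana.cor312_of_represented`/`ForkRegions` readings (the inclusion is exactly as strong as the
inequality it yields). PROVED. [folklore] -/
theorem specialCase_iff : T.SpecialCase ↔ T.h ≤ T.ε := by
  simp only [SpecialCase, forget, lamQ, lamThetaInd, Set.mem_Iic]
  constructor <;> intro h <;> linarith

/-- The toy model read through the frame `Itw` of (a^itw)–(f^itw) at an identified value `x ∈ ℝ` of «∗»:
`q-itw.` := "`∗ ↦ −h`" (`x = −h`), `Θ-itw.` := "`∗ ↦ −2h`" (`x = −2h`), `Θ-itw./indets.` := "`∗ ↦ ℝ_{≤−2h+ϵ}`"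
(`x ≤ −2h + ϵ`) — the dictionary of (f^toy) p. 191 l. 28–30. [cite: Mochizuki2012, III Rmk 3.12.2 (ii) p.191] -/
def itwAt (x : ℝ) : Itw :=
  ⟨x = forget T.lamQ, x = forget T.lamTheta, x ∈ T.lamThetaInd⟩

/-- (f^toy) ⟷ (f^itw): the first arrow of the (f^itw)-display holds at every identified value iff
`SpecialCase`. PROVED. [cite: Mochizuki2012, III Rmk 3.12.2 (ii) p.191] -/
theorem itwAt_firstArrow_iff : (∀ x, (T.itwAt x).FirstArrow) ↔ T.SpecialCase := by
  constructor
  · intro h; exact (h (forget T.lamQ) rfl).2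
  · intro hs x hx; exact ⟨hx, by rw [hx]; exact hs⟩

/-- (a^toy) in the frame of (c^itw): with the copies identified, "(q-itw.) ∧ (Θ-itw.)" at a single value
`x` is contradictory (`−h ≠ −2h`) — the toy-level reason the abstract symbol and the distinct labels
((b^toy), (c^toy)) are needed for (c^itw)'s «∧». PROVED. [cite: Mochizuki2012, III Rmk 3.12.2 (ii) p.190] -/
theorem itwAt_citw_false (x : ℝ) : ¬ (T.itwAt x).Citw := by
  rintro ⟨h1, h2⟩
  exact T.atoy_forget_ne (h1.symm.trans h2)

end Toy

end Summit.ABC.IUTFork.Cor312Rmk
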